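import Summits.QuantumFields.YangMills.Theorems.LuscherReductionTwistedTraceScalingGnomonicMagnetic
import Summits.QuantumFields.YangMills.Theorems.LuscherReductionTwistedTraceScalingVacuumPattern
import Mathlib.MeasureTheory.Measure.Haar.InnerProductSpace
import HarnessLib

/-!
# Transport: Lebesgue measure on the chart coordinates `Edge → ℝ³` is the volume of `LinkSpace L`, and the gnomonic density on the bulk
# (lane B of S-BASE, crux `TwistedTraceScaling` stmt-QuantumFields-20203; the Laplace step of both COARSE lanes)

`…VacuumPattern.integral_configMeasure_eq_vacuumChart` writes bulk-supported integrals over `SU(2)^E` as Lebesgue integrals over the chart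
coordinates `w : Edge 3 L → Fin 3 → ℝ` against `∏_e (2π²)⁻¹(1+|w_e|²)⁻²`; the harmonic model (`…StiffHessian`, `…GaussianTail`,
`Literature…GaussianTransferKernel`) lives on the Euclidean space `LinkSpace L = ℝ^{E×3}`.  This file identifies the two:
* `measurePreserving_curry_pi` — currying `(ι × κ → X) ≃ (ι → κ → X)` preserves finite products of a σ-finite measure (Mathlib has the
  probability-measure case via `infinitePi`; here by `Measure.pi_eq` on boxes);
* `chartEquiv : (Edge 3 L → Fin 3 → ℝ) ≃ᵐ LinkSpace L`, `⇑chartEquiv = chartVec`, volume preserving (`volume_preserving_chartVec`), hence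
  `∫ F (chartVec w) dw = ∫ x, F x` (`integral_comp_chartVec`) and `∫ G w dw = ∫ x, G (linkCurry x)` (`integral_eq_integral_linkCurry`);
* density bounds on the bulk `Σ_a w_e a² ≤ ρ²`: `((2π²)⁻¹(1+ρ²)⁻²)^{|E|} ≤ ∏_e w(w_e) ≤ (2π²)^{−|E|}` (`latGnDensityReal_ge_of_ball`).
HONEST FRAMING: measure-theoretic plumbing; femto rung R2b1 (stub of a child of a CONDITIONAL route); not a gap, not Clay.
-/

set_option autoImplicit false

noncomputable section

open MeasureTheory Real
open scoped BigOperators ENNReal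
open Literature.MathematicalPhysics.QuantumFieldTheory
open Literature.MathematicalPhysics.QuantumLattice
open Literature.MathematicalPhysics.QuantumFieldTheory.Balaban1983to89.T4CubeChartGnomonic (gnoWeight gnoWeight_pos gnoWeight_le)

namespace Summit.QuantumFields.YangMills.Theorems.FemtoTransferGap.TwoLattice.GnChart

open Summit.QuantumFields.YangMills.Theorems.FemtoTransferGap
open Summit.QuantumFields.YangMills.Theorems.FemtoTransferGap.TwoLattice
open Summit.QuantumFields.YangMills.Theorems.FemtoTransferGap.TwoLattice.Stiff

/-! ## §1 Currying preserves finite products of a σ-finite measure -/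

/-- Uncurrying `(ι → κ → X) → (ι × κ → X)` pushes `⊗_ι ⊗_κ μ` to `⊗_{ι×κ} μ` (σ-finite `μ`, finite index types). [folklore] -/
theorem measurePreserving_curry_symm_pi (ι κ X : Type*) [Fintype ι] [Fintype κ] [MeasurableSpace X] (μ : Measure X) [SigmaFinite μ] :
    MeasurePreserving (MeasurableEquiv.curry ι κ X).symm (Measure.pi fun _ : ι => Measure.pi fun _ : κ => μ)
      (Measure.pi fun _ : ι × κ => μ) := by
  refine ⟨(MeasurableEquiv.curry ι κ X).symm.measurable, ?_⟩
  symm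
  refine Measure.pi_eq fun s hs => ?_
  rw [Measure.map_apply (MeasurableEquiv.curry ι κ X).symm.measurable (MeasurableSet.univ_pi hs)]
  have hpre : (MeasurableEquiv.curry ι κ X).symm ⁻¹' Set.pi Set.univ s =
      Set.pi Set.univ fun i => Set.pi Set.univ fun k => s (i, k) := by
    ext f
    simp only [MeasurableEquiv.coe_curry_symm, Set.mem_preimage, Set.mem_univ_pi, Function.uncurry_apply_pair, Prod.forall]
  rw [hpre, Measure.pi_pi]
  simp_rw [Measure.pi_pi]
  rw [← Finset.prod_product', Finset.univ_product_univ]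

/-- Currying `(ι × κ → X) → (ι → κ → X)` pushes `⊗_{ι×κ} μ` to `⊗_ι ⊗_κ μ`. [folklore] -/
theorem measurePreserving_curry_pi (ι κ X : Type*) [Fintype ι] [Fintype κ] [MeasurableSpace X] (μ : Measure X) [SigmaFinite μ] :
    MeasurePreserving (MeasurableEquiv.curry ι κ X) (Measure.pi fun _ : ι × κ => μ)
      (Measure.pi fun _ : ι => Measure.pi fun _ : κ => μ) := by
  have h := (measurePreserving_curry_symm_pi ι κ X μ).symm
  rwa [MeasurableEquiv.symm_symm] at h

/-! ## §2 The chart coordinates and `LinkSpace L` -/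

variable (L : ℕ) [NeZero L]

/-- The measurable equivalence `(Edge 3 L → ℝ³) ≃ᵐ LinkSpace L`, `w ↦ chartVec w` (uncurry, then `toLp 2`). [folklore] -/
def chartEquiv : (Edge 3 L → Fin 3 → ℝ) ≃ᵐ LinkSpace L :=
  (MeasurableEquiv.curry (Edge 3 L) (Fin 3) ℝ).symm.trans (MeasurableEquiv.toLp 2 (Edge 3 L × Fin 3 → ℝ))

omit [NeZero L] in
/-- `⇑chartEquiv = chartVec`. [folklore] -/
@[simp] theorem chartEquiv_apply (w : Edge 3 L → Fin 3 → ℝ) : chartEquiv L w = chartVec w := rfl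

omit [NeZero L] in
/-- `⇑chartEquiv = chartVec` as functions. [folklore] -/
theorem coe_chartEquiv : ⇑(chartEquiv L) = (chartVec : (Edge 3 L → Fin 3 → ℝ) → LinkSpace L) := rfl

variable {L} in
/-- The inverse chart: `linkCurry x e a = x (e, a)`. [folklore] -/
def linkCurry (x : LinkSpace L) : Edge 3 L → Fin 3 → ℝ := fun e a => x (e, a)

omit [NeZero L] in
/-- `⇑chartEquiv.symm = linkCurry`. [folklore] -/
@[simp] theorem chartEquiv_symm_apply (x : LinkSpace L) : (chartEquiv L).symm x = linkCurry x := rfl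

omit [NeZero L] in
/-- `linkCurry (chartVec w) = w`. [folklore] -/
@[simp] theorem linkCurry_chartVec (w : Edge 3 L → Fin 3 → ℝ) : linkCurry (chartVec w) = w := rfl

omit [NeZero L] in
/-- `chartVec (linkCurry x) = x`. [folklore] -/
@[simp] theorem chartVec_linkCurry (x : LinkSpace L) : chartVec (linkCurry x) = x := (chartEquiv L).apply_symm_apply x

/-- ★ `w ↦ chartVec w` is volume preserving from Lebesgue measure on `Edge → ℝ³` to the volume of `LinkSpace L`. [folklore] -/
theorem volume_preserving_chartEquiv : MeasurePreserving (chartEquiv L) volume volume := by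
  have h1 : MeasurePreserving (MeasurableEquiv.curry (Edge 3 L) (Fin 3) ℝ).symm
      (volume : Measure (Edge 3 L → Fin 3 → ℝ)) (volume : Measure (Edge 3 L × Fin 3 → ℝ)) :=
    measurePreserving_curry_symm_pi (Edge 3 L) (Fin 3) ℝ volume
  exact h1.trans (PiLp.volume_preserving_toLp (Edge 3 L × Fin 3))

/-- The same for the bare function `chartVec`. [folklore] -/
theorem volume_preserving_chartVec : MeasurePreserving (chartVec : (Edge 3 L → Fin 3 → ℝ) → LinkSpace L) volume volume :=
  volume_preserving_chartEquiv L

/-- ★ Change of variables `∫ F (chartVec w) dw = ∫ x, F x` (any `F`; no integrability needed). [folklore] -/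
theorem integral_comp_chartVec (F : LinkSpace L → ℝ) : ∫ w : Edge 3 L → Fin 3 → ℝ, F (chartVec w) = ∫ x : LinkSpace L, F x :=
  (volume_preserving_chartEquiv L).integral_comp' (f := chartEquiv L) F

/-- … and `∫ G w dw = ∫ x, G (linkCurry x) dx`. [folklore] -/
theorem integral_eq_integral_linkCurry (G : (Edge 3 L → Fin 3 → ℝ) → ℝ) :
    ∫ w : Edge 3 L → Fin 3 → ℝ, G w = ∫ x : LinkSpace L, G (linkCurry x) := by
  rw [← integral_comp_chartVec L (fun x => G (linkCurry x))]
  rfl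

/-- The `lintegral` version `∫⁻ F (chartVec w) dw = ∫⁻ x, F x`. [folklore] -/
theorem lintegral_comp_chartVec (F : LinkSpace L → ℝ≥0∞) : ∫⁻ w : Edge 3 L → Fin 3 → ℝ, F (chartVec w) = ∫⁻ x : LinkSpace L, F x :=
  (volume_preserving_chartEquiv L).lintegral_comp_emb (chartEquiv L).measurableEmbedding F

/-- `‖chartVec w‖² = Σ_e Σ_a w_e a²`. [folklore] -/
theorem norm_chartVec_sq (w : Edge 3 L → Fin 3 → ℝ) : ‖chartVec w‖ ^ 2 = ∑ e, ∑ a, w e a ^ 2 := by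
  rw [EuclideanSpace.norm_sq_eq, Fintype.sum_prod_type]
  simp only [chartVec_apply, Real.norm_eq_abs, sq_abs]

/-! ## §3 The gnomonic density on the bulk -/

/-- On the bulk `Σ_a w_e a² ≤ ρ²` (every link): `((2π²)⁻¹ ((1+ρ²)⁻¹)²)^{|E|} ≤ ∏_e w(w_e)`. [folklore] -/
theorem latGnDensityReal_ge_of_ball {ρ : ℝ} (w : Edge 3 L → Fin 3 → ℝ) (hw : ∀ e, ∑ a, w e a ^ 2 ≤ ρ ^ 2) :
    ((2 * π ^ 2)⁻¹ * ((1 + ρ ^ 2)⁻¹) ^ 2) ^ Fintype.card (Edge 3 L) ≤ latGnDensityReal L w := by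
  unfold latGnDensityReal
  rw [← Finset.card_univ, ← Finset.prod_const]
  refine Finset.prod_le_prod (fun e _ => by positivity) fun e _ => ?_
  unfold gnoWeight
  have h0 : 0 ≤ ∑ i, w e i ^ 2 := Finset.sum_nonneg fun i _ => sq_nonneg _
  have h1 : (1 + ρ ^ 2)⁻¹ ≤ (1 + ∑ i, w e i ^ 2)⁻¹ := by
    apply inv_anti₀ (by positivity); linarith [hw e]
  have h2 : ((1 + ρ ^ 2)⁻¹) ^ 2 ≤ ((1 + ∑ i, w e i ^ 2)⁻¹) ^ 2 := pow_le_pow_left₀ (by positivity) h1 2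
  exact mul_le_mul_of_nonneg_left h2 (by positivity)

/-- Two-sided: on the bulk the density lies in `[((2π²)⁻¹(1+ρ²)⁻²)^{|E|}, ((2π²)⁻¹)^{|E|}]`, and the ratio of the two ends is `((1+ρ²)²)^{|E|}
≤ exp(2|E|ρ²)`. [folklore] -/
theorem latGnDensityReal_bulk_ratio {ρ : ℝ} (w : Edge 3 L → Fin 3 → ℝ) (hw : ∀ e, ∑ a, w e a ^ 2 ≤ ρ ^ 2) :
    ((2 * π ^ 2)⁻¹) ^ Fintype.card (Edge 3 L) ≤
        Real.exp (2 * Fintype.card (Edge 3 L) * ρ ^ 2) * latGnDensityReal L w ∧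
      latGnDensityReal L w ≤ ((2 * π ^ 2)⁻¹) ^ Fintype.card (Edge 3 L) := by
  refine ⟨?_, (latGnDensityReal_pos_le L w).2⟩
  have hlow := latGnDensityReal_ge_of_ball L w hw
  set n := Fintype.card (Edge 3 L)
  have hq : 0 < 1 + ρ ^ 2 := by positivity
  -- `(1+ρ²)² ≤ exp(2ρ²)`
  have he1 : (1 + ρ ^ 2) ^ 2 ≤ Real.exp (2 * ρ ^ 2) := by
    have := Real.add_one_le_exp (ρ ^ 2)
    calc (1 + ρ ^ 2) ^ 2 ≤ Real.exp (ρ ^ 2) ^ 2 := pow_le_pow_left₀ hq.le (by linarith) 2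
      _ = Real.exp (2 * ρ ^ 2) := by rw [← Real.exp_nat_mul]; norm_num
  have hexp : Real.exp (2 * n * ρ ^ 2) = Real.exp (2 * ρ ^ 2) ^ n := by
    rw [← Real.exp_nat_mul]; ring_nf
  -- `c^n = (c q⁻²)^n · (q²)^n ≤ latGnDensityReal · exp(2nρ²)`
  have hc : ((2 * π ^ 2)⁻¹ : ℝ) ^ n = ((2 * π ^ 2)⁻¹ * ((1 + ρ ^ 2)⁻¹) ^ 2) ^ n * ((1 + ρ ^ 2) ^ 2) ^ n := by
    rw [← mul_pow]; congr 1; field_simp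
  rw [hc, hexp, mul_comm (Real.exp _ ^ n)]
  exact mul_le_mul hlow (pow_le_pow_left₀ (by positivity) he1 n) (by positivity) (latGnDensityReal_pos_le L w).1.le

/-! ## §4 Bulk-supported integrals over `SU(2)^E` as integrals over `LinkSpace L` -/

/-- ★ **Bulk integrals live on `LinkSpace L`**: for a bounded measurable `g` vanishing whenever some link has `‖V_e − 1‖_F² ≥ 4`,
`∫ g dσ^{⊗E} = ∫_{LinkSpace L} (∏_e w((linkCurry x)_e)) · g(P(linkCurry x)) dx`. [folklore] -/
theorem integral_configMeasure_eq_linkSpace {g : GaugeConfig 3 L SU2 → ℝ} (hg : Measurable g) (hb : ∃ C : ℝ, ∀ U, |g U| ≤ C)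
    (h0 : ∀ V : GaugeConfig 3 L SU2, (∃ e, 4 ≤ frobNorm ((V e : Matrix (Fin 2) (Fin 2) ℂ) - 1) ^ 2) → g V = 0) :
    ∫ U, g U ∂(configMeasure SU2 L) =
      ∫ x : LinkSpace L, latGnDensityReal L (linkCurry x) * g (latPatternChart L (fun _ => false) (linkCurry x)) := by
  rw [integral_configMeasure_eq_vacuumChart_of_frobNorm L hg hb h0]
  exact integral_eq_integral_linkCurry L _

end Summit.QuantumFields.YangMills.Theorems.FemtoTransferGap.TwoLattice.GnChart

end
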